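import Summits.SmoothPoincare4.SmoothPoincare4.Theses.SymplecticOrigami
import Literature.Topology.FourManifolds.ClosedBallProofs
import Literature.Topology.FourManifolds.CorkDecompositionSplitting

/-!
# `OrigamiRung` — negative-side support: twisted-sphere endgame stubs are summit-implied;
# `T2` is inherited through the surface embedding

Crux `SymplecticOrigami.OrigamiRung` (item stmt-SmoothPoincare4-7843), cdisprove seat (gen 3).
Classification facts about the STUBS of the crux's filed lines (`Cruxes/OrigamiRung/Lines/*`), for
the lead and for the audit:

* `isTwistedSphere_of_diffeomorph_sphere_four`: a smooth 4-manifold diffeomorphic to `S⁴` is the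
  twisted sphere `D⁴ ∪_{id} D⁴` (tree theorems `isDouble_sphere_holds`, `isTwistedSphere_refl_sphere`,
  transported by `IsBoundaryGluing.diffeomorph_comp`).
* `twistedSphere_of_smoothPoincare4`: hence under `SmoothPoincare4` EVERY smooth homotopy 4-sphere
  `M` satisfies `∃ φ, IsTwistedSphere 3 φ M`.  Consequence: every stub of the shape
  "`M ≃ₕ S⁴ → (fold data, genus-0 export, Gromov antecedent, …) → ∃ φ, IsTwistedSphere 3 φ M`" —
  the hardest stubs `stub_genusZeroEndgame` (registered line `rank-one-integrality-pinch`) and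
  `stub_genusZeroTwisted` (line `round-tube-pullback-collar`) — is implied by the summit uniformly in
  its data, exactly like the crux (`Negative.not_smoothPoincare4_of_not_origamiRung`): no
  counterexample exists short of an exotic `S⁴`, so these stubs are judged on method only.  (The
  verbatim instantiations are checked in the crux's `Disproof.lean` §5b.)
* `t2Space_of_isSmoothEmbedding`: a type smoothly embedded in a Hausdorff manifold is Hausdorff —
  the reason the un-`T2` binders `S i`, `Z` of the crux are harmless, and the free repair of line
  `pair-rigidity-endgame`'s Stub 3 (`stub_sphereOfGenusZero`, which assumes `T2Space` for neither `N`
  nor `S` and is false as typed by a doubled-point sphere; `Disproof.lean` §5c).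
-/

noncomputable section

-- the prescribed namespace `Summit.<P>.<Sub>.…` duplicates `SmoothPoincare4` (P = Sub)
set_option linter.dupNamespace false

open scoped Manifold ContDiff Topology ContinuousMap

namespace Summit.SmoothPoincare4.SmoothPoincare4.Theorems.OrigamiRung.Negative

open Literature.Topology.FourManifolds (IsTwistedSphere isDouble_sphere_holds
  isTwistedSphere_refl_sphere)

/-- **A manifold diffeomorphic to `S⁴` is a twisted sphere** (`D⁴ ∪_{id} D⁴` transported along the
diffeomorphism; tree theorems `isDouble_sphere_holds`, `isTwistedSphere_refl_sphere`,
`IsBoundaryGluing.diffeomorph_comp`). [folklore] -/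
theorem isTwistedSphere_of_diffeomorph_sphere_four
    {M : Type} [TopologicalSpace M] [ChartedSpace (EuclideanSpace ℝ (Fin 4)) M]
    [IsManifold (𝓡 4) ∞ M]
    (e : M ≃ₘ⟮𝓡 4, 𝓡 4⟯ (Metric.sphere (0 : EuclideanSpace ℝ (Fin 5)) 1)) :
    ∃ φ : (Metric.sphere (0 : EuclideanSpace ℝ (Fin 4)) 1) ≃ₘ⟮𝓡 3, 𝓡 3⟯
        (Metric.sphere (0 : EuclideanSpace ℝ (Fin 4)) 1), IsTwistedSphere 3 φ M := by
  refine ⟨Diffeomorph.refl (𝓡 3) (Metric.sphere (0 : EuclideanSpace ℝ (Fin 4)) 1) ∞, ?_⟩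
  have h : IsTwistedSphere 3 (Diffeomorph.refl (𝓡 3) (Metric.sphere (0 : EuclideanSpace ℝ (Fin 4)) 1) ∞)
      (Metric.sphere (0 : EuclideanSpace ℝ (Fin 5)) 1) :=
    isTwistedSphere_refl_sphere (isDouble_sphere_holds (n := 3))
  exact Literature.Topology.FourManifolds.IsBoundaryGluing.diffeomorph_comp h e.symm

/-- **Under the summit statement every smooth homotopy 4-sphere is a twisted sphere.**  Hence any
stub of the shape "`M ≃ₕ S⁴ → (data) → ∃ φ, IsTwistedSphere 3 φ M`" is implied by `SmoothPoincare4`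
uniformly in the data and admits no counterexample short of an exotic `S⁴`. [folklore] -/
theorem twistedSphere_of_smoothPoincare4 (h : _root_.SmoothPoincare4)
    (M : Type) [TopologicalSpace M] [T2Space M] [SecondCountableTopology M]
    [ChartedSpace (EuclideanSpace ℝ (Fin 4)) M] [IsManifold (𝓡 4) ∞ M]
    (e : M ≃ₕ (Metric.sphere (0 : EuclideanSpace ℝ (Fin 5)) 1)) :
    ∃ φ : (Metric.sphere (0 : EuclideanSpace ℝ (Fin 4)) 1) ≃ₘ⟮𝓡 3, 𝓡 3⟯
        (Metric.sphere (0 : EuclideanSpace ℝ (Fin 4)) 1), IsTwistedSphere 3 φ M := by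
  obtain ⟨d⟩ := h M inferInstance inferInstance e
  exact isTwistedSphere_of_diffeomorph_sphere_four d

/-- **`T2` is inherited through a smooth embedding** (Mathlib `IsEmbedding.t2Space`): the surface
`S` of a symplectically embedded pair `b : S ↪ N` with `N` Hausdorff is Hausdorff, so adding
`[T2Space N]` to a surface-recognition stub costs nothing where it is used. [folklore] -/
theorem t2Space_of_isSmoothEmbedding {N S : Type} [TopologicalSpace N] [T2Space N]
    [ChartedSpace (EuclideanSpace ℝ (Fin 4)) N] [TopologicalSpace S]
    [ChartedSpace (EuclideanSpace ℝ (Fin 2)) S] {b : S → N}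
    (hb : Manifold.IsSmoothEmbedding (𝓡 2) (𝓡 4) ∞ b) : T2Space S :=
  hb.isEmbedding.t2Space

end Summit.SmoothPoincare4.SmoothPoincare4.Theorems.OrigamiRung.Negative

end
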